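import Literature.NumberTheory.NumberFields.QuadraticSqrtTwoNormTwoPrimeCertificate
import Literature.NumberTheory.IwasawaTheory.NarrowFukudaCertificateLayerPolynomialModels
import HarnessLib

/-!
# A prime `𝔭₁` of norm `2` with `2 ∉ 𝔭₁²` in the QUARTIC cyclotomic layer `L = K(θ)`, `θ⁴ − 4θ² + 2 = 0`: `e = 4`, `f = 1`,
# `θ, 2 + θ ∈ P ∖ P²`, `2, π₁ ∈ P⁴ ∖ P⁵`, and the BASE-FIELD CERTIFICATE `d(A − 1) = π₁²γ₀`, `dB = π₁²γ₁`, `dC = π₁²γ₂`, `dD = π₁²γ₃`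
# ⟹ `A + Bθ + Cθ² + Dθ³ − 1 ∈ P⁸ ∖ P⁹`

Topic `NumberTheory/IwasawaTheory` (namespace = path).  THEOREMS ONLY (no definition, no named fact, no instance, no `sorry`); unconditional.
Written by the prover seat `bsd-line-att-p3` g44 (cell `bsd-f1-sign2`, route `AlignedTransportAtTwo`, crux C2 stmt-BirchSwinnertonDyer-22298;
`--supports`, closes nothing).  The quartic-layer twin of `NumberFields/QuadraticSqrtTwoNormTwoPrimeCertificate.lean` (att-p3 g41: the same
bookkeeping for `L = K(√2)`, `e = 2`, certificate `v − 1 ∈ P⁴ ∖ P⁵`) and the arithmetic half of the LAYER-TWO unit door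
(`ClassicalMuVanishesLayerTwoUnitCertificateTwo.lean`): the hypotheses `2 ∈ P⁴ ∖ P⁵`, `m ∈ P ∖ P²`, `v − 1 ∈ P⁸ ∖ P⁹` of the dyadic non-norm lemma
at `e = 4`, `f = 1` (`NumberFields/DyadicUnitSquaresRamifiedPrimeFour.lean`, O'Meara 63:10) are DERIVED for the prime `P` of `L ∋ θ`,
`θ⁴ − 4θ² + 2 = 0`, `[L : K] = 4` Galois, above a degree-one unramified dyadic prime `𝔭₁` of `K`, from data in `𝓞_K` alone.

* ★ `ramificationIdx_eq_four_of_quartic_root` — `[L:K] = 4` Galois, `θ ∈ 𝓞_L` with `θ⁴ − 4θ² + 2 = 0`, `𝔭₁ ∋ 2` with `2 ∉ 𝔭₁²`, `P ∣ 𝔭₁`: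
  `e(P|𝔭₁) = 4`, ONE prime above `𝔭₁`, `f(P|𝔭₁) = 1` (`4 ∣ e(P|2ℤ) = e(𝔭₁|2ℤ)·e(P|𝔭₁)` by the tree's `pow_dvd_ramificationIdx_int_of_iterate_root` —
  `θ` is a root of `Ψ₂ = (X² − 2)² − 2` and `(2) = (θ)⁴` —, `e(𝔭₁|2ℤ) = 1`, fundamental identity `g·e·f = 4`); `card_quotient_eq_two_of_quartic_root`
  (`𝓞_L/P = 𝔽₂`).
* `two_mem_pow_four_and_mem_of_quartic_root` (`2 ∈ P⁴ ∖ P⁵`; `θ ∈ P ∖ P²`; `2 + θ ∈ P ∖ P²` — from `θ⁴ = 2(2θ² − 1)`);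
  `algebraMap_mem_pow_four_of_mem_of_not_mem_sq` (`π₁ ∈ 𝔭₁ ∖ 𝔭₁²` ⟹ `π₁ ∈ P⁴ ∖ P⁵`: `𝔭₁𝓞_L ≤ P⁴` and `𝔭₁ = (π₁) + 𝔭₁²`).
* ★★ `sub_one_mem_pow_eight_of_baseCert` — `A, B, C, D, π₁, d, γ₀, γ₁, γ₂, γ₃ ∈ 𝓞_K`, `π₁ ∈ 𝔭₁ ∖ 𝔭₁²`, `d, γ₀ ∉ 𝔭₁`, `d(A − 1) = π₁²γ₀`, `dB = π₁²γ₁`,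
  `dC = π₁²γ₂`, `dD = π₁²γ₃` ⟹ `η = A + Bθ + Cθ² + Dθ³` has `η − 1 ∈ P⁸ ∖ P⁹` (`d(η − 1) = π₁²(γ₀ + γ₁θ + γ₂θ² + γ₃θ³)`, `v_P(d) = 0`,
  `v_P(γ₀ + γ₁θ + ⋯) = 0` as `θ ∈ P`, `v_P(π₁) = 4`; multiplicities of `P` in principal ideals).  All conditions are identities or ideal memberships
  in `𝓞_K`; they are insensitive to WHICH of the four roots `±θ, ±(θ³ − 3θ)` is used.

HONEST SCOPE: elementary Dedekind bookkeeping (Neukirch I §8); nothing specific to any summit; BSD is not advanced by this file.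

## References

* J. Neukirch, *Algebraic Number Theory* (1999), Ch. I §8 Prop. (8.2) (fundamental identity; `N𝔭 = p^f`), Ch. II §6 (Eisenstein polynomials,
  `(2) = (θ)⁴` in `ℚ(ζ₁₆)⁺`). [NeukirchANT1999]
* L. C. Washington, *Introduction to Cyclotomic Fields*, 2nd ed. (1997), §13.1 Prop. 13.2 and Lemma 13.3 (`ℚ_2 = ℚ(ζ₁₆)⁺` is totally ramified at
  `2`; the layer `K_2 = K·ℚ_2`). [Washington1997]
* O. T. O'Meara, *Introduction to Quadratic Forms* (1963), §63A (63:1), §63B (63:10) (the local statement these hypotheses feed). [Omeara1963]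
-/

noncomputable section

open NumberField IsDedekindDomain Field UniqueFactorizationMonoid
open scoped nonZeroDivisors

namespace Literature.NumberTheory.IwasawaTheory

open Literature.NumberTheory.NumberFields Literature.NumberTheory.EllipticCurves

/-! ## §0 Valuation bookkeeping at a prime of a Dedekind domain (count of `P` in a factorisation) -/

section Count

variable {R : Type*} [CommRing R] [IsDedekindDomain R]

/-- `I ≤ P^k` iff `k ≤` the multiplicity of `P` in `I` (Dedekind domain, `I ≠ 0`, `P ≠ 0` prime). [folklore] -/
private theorem le_pow_iff_le_count₄ {P I : Ideal R} [hP : P.IsPrime] (hP0 : P ≠ ⊥) (hI : I ≠ ⊥) (k : ℕ) :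
    I ≤ P ^ k ↔ k ≤ (normalizedFactors I).count P := by
  classical
  rw [← Ideal.dvd_iff_le, pow_dvd_iff_le_emultiplicity,
    emultiplicity_eq_count_normalizedFactors (Ideal.prime_of_isPrime hP0 hP).irreducible hI, normalize_eq,
    Nat.cast_le]

/-- `x ∈ P^k` iff `k ≤` the multiplicity of `P` in `(x)` (`x ≠ 0`). [folklore] -/
private theorem mem_pow_iff_le_count₄ {P : Ideal R} [hP : P.IsPrime] (hP0 : P ≠ ⊥) {x : R} (hx : x ≠ 0) (k : ℕ) :
    x ∈ P ^ k ↔ k ≤ (normalizedFactors (Ideal.span {x})).count P := by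
  rw [← Ideal.span_singleton_le_iff_mem]
  exact le_pow_iff_le_count₄ hP0 (by rwa [Ne, Ideal.span_singleton_eq_bot]) k

/-- The multiplicity of `P` in `(xy)` is the sum of the multiplicities (`x, y ≠ 0`). [folklore] -/
private theorem count_span_mul₄ {P : Ideal R} {x y : R} (hx : x ≠ 0) (hy : y ≠ 0) :
    (normalizedFactors (Ideal.span {x * y})).count P =
      (normalizedFactors (Ideal.span {x})).count P + (normalizedFactors (Ideal.span {y})).count P := by
  classical
  rw [← Ideal.span_singleton_mul_span_singleton,
    normalizedFactors_mul (by rw [Ne, Ideal.zero_eq_bot, Ideal.span_singleton_eq_bot]; exact hx)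
      (by rw [Ne, Ideal.zero_eq_bot, Ideal.span_singleton_eq_bot]; exact hy),
    Multiset.count_add]

/-- The multiplicity of `P` in `(x)` is `n` when `x ∈ P^n ∖ P^(n+1)`. [folklore] -/
private theorem count_span_eq_of_mem_of_not_mem₄ {P : Ideal R} [hP : P.IsPrime] {x : R} {n : ℕ} (hle : x ∈ P ^ n)
    (hlt : x ∉ P ^ (n + 1)) : (normalizedFactors (Ideal.span {x})).count P = n :=
  Ideal.count_normalizedFactors_eq (by rwa [Ideal.span_singleton_le_iff_mem]) (by rwa [Ideal.span_singleton_le_iff_mem])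

end Count

/-! ## §1 A degree-one unramified dyadic prime `𝔭₁` of `K` in the quartic layer `L = K(θ)`, `θ⁴ − 4θ² + 2 = 0` -/

section Quartic

variable {K L : Type} [Field K] [NumberField K] [Field L] [NumberField L] [Algebra K L]

omit [NumberField K] in
/-- A prime of `𝓞 K` containing `2` lies over `2ℤ`. [folklore] -/
private theorem liesOver_span_two₄ {p : Ideal (𝓞 K)} [p.IsPrime] (h2 : (2 : 𝓞 K) ∈ p) :
    p.LiesOver (Ideal.span {(2 : ℤ)}) := by
  refine ⟨?_⟩
  have hmax : (Ideal.span {(2 : ℤ)}).IsMaximal :=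
    PrincipalIdealRing.isMaximal_of_irreducible (Int.prime_two.irreducible)
  have hle : Ideal.span {(2 : ℤ)} ≤ p.under ℤ := by
    rw [Ideal.span_le, Set.singleton_subset_iff]
    change algebraMap ℤ (𝓞 K) 2 ∈ p
    rwa [map_ofNat]
  exact (hmax.eq_of_le (Ideal.IsPrime.ne_top inferInstance) hle)

omit [NumberField L] in
/-- A root of `X⁴ − 4X² + 2` is a root of `Ψ₂ = (X² − 2)² − 2` (in `L`). [cite: Washington1997, §13.1 (`ℚ_2 = ℚ(ζ₁₆)⁺`)] -/
private theorem iterate_two_eq_zero_of_quartic {θ : 𝓞 L} (hθ : θ ^ 4 - 4 * θ ^ 2 + 2 = 0) :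
    (fun x : L => x ^ 2 - 2)^[2] (θ : L) = 0 := by
  rw [iterate_sq_sub_two_two]
  have h := congrArg (algebraMap (𝓞 L) L) hθ
  simp only [map_add, map_sub, map_mul, map_pow, map_ofNat, map_zero] at h
  change ((θ : L) ^ 2 - 2) ^ 2 - 2 = 0
  linear_combination h

variable [IsGalois K L]

/-- ★ **`e(P | 𝔭₁) = 4`, ONE prime above `𝔭₁`, `f(P | 𝔭₁) = 1`** for `L ∋ θ` with `θ⁴ − 4θ² + 2 = 0`, `[L : K] = 4` Galois, and a prime `𝔭₁ ∋ 2`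
of `K` with `2 ∉ 𝔭₁²`: `e(P | 2ℤ) = e(𝔭₁ | 2ℤ)·e(P | 𝔭₁)` is divisible by `4` (`(2) = (θ)⁴`, tree `pow_dvd_ramificationIdx_int_of_iterate_root`) while
`e(𝔭₁ | 2ℤ) = 1`, so `4 ∣ e(P | 𝔭₁) ∣ [L : K] = 4` (fundamental identity `g·e·f = 4`). [cite: NeukirchANT1999, Ch. I §8 Prop. (8.2)]
[cite: Washington1997, §13.1 Prop. 13.2 and Lemma 13.3] -/
theorem ramificationIdx_eq_four_of_quartic_root (h4 : Module.finrank K L = 4) {θ : 𝓞 L} (hθ : θ ^ 4 - 4 * θ ^ 2 + 2 = 0)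
    (𝔭₁ : Ideal (𝓞 K)) [𝔭₁.IsPrime] (h2𝔭 : (2 : 𝓞 K) ∈ 𝔭₁) (hunr : (2 : 𝓞 K) ∉ 𝔭₁ ^ 2)
    (P : Ideal (𝓞 L)) [P.IsPrime] [P.LiesOver 𝔭₁] :
    P.ramificationIdx (𝓞 K) = 4 ∧ (𝔭₁.primesOver (𝓞 L)).ncard = 1 ∧ 𝔭₁.inertiaDegIn (𝓞 L) = 1 := by
  classical
  haveI := liesOver_span_two₄ h2𝔭
  haveI : P.LiesOver (Ideal.span {(2 : ℤ)}) := Ideal.LiesOver.trans P 𝔭₁ _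
  have hP2 : P.under (𝓞 K) = 𝔭₁ := (Ideal.over_def P 𝔭₁).symm
  have htower : P.ramificationIdx ℤ = 𝔭₁.ramificationIdx ℤ * P.ramificationIdx (𝓞 K) := by
    have h := Ideal.ramificationIdx_tower (P.under (𝓞 K)) P (R := ℤ)
    rwa [hP2] at h
  have hdvd4 : 4 ∣ P.ramificationIdx ℤ := by
    have h := pow_dvd_ramificationIdx_int_of_iterate_root (iterate_two_eq_zero_of_quartic hθ) P
    norm_num at h
    exact h
  rw [htower, ramificationIdx_int_eq_one_of_two_not_mem_sq 𝔭₁ h2𝔭 hunr, one_mul] at hdvd4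
  -- the fundamental identity `g · (e · f) = 4`
  have hfund := Ideal.ncard_primesOver_mul_ramificationIdxIn_mul_inertiaDegIn 𝔭₁ (𝓞 L) (L ≃ₐ[K] L)
  rw [IsGalois.card_aut_eq_finrank, h4, Ideal.ramificationIdxIn_eq_ramificationIdx 𝔭₁ P (L ≃ₐ[K] L)] at hfund
  have hedvd : P.ramificationIdx (𝓞 K) ∣ 4 :=
    ⟨(𝔭₁.primesOver (𝓞 L)).ncard * 𝔭₁.inertiaDegIn (𝓞 L), by rw [← hfund]; ring⟩
  have he4 : P.ramificationIdx (𝓞 K) = 4 := Nat.dvd_antisymm hedvd hdvd4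
  rw [he4] at hfund
  have hgf : (𝔭₁.primesOver (𝓞 L)).ncard * 𝔭₁.inertiaDegIn (𝓞 L) = 1 := by linarith
  exact ⟨he4, Nat.eq_one_of_mul_eq_one_right hgf, Nat.eq_one_of_mul_eq_one_left hgf⟩

/-- **The residue field of `P` is `𝔽₂`** (`#(𝓞_L/P) = 2`): `N(P) = N(𝔭₁)^{f(P|𝔭₁)} = 2`. [cite: NeukirchANT1999, Ch. I §8 (8.2)] -/
theorem card_quotient_eq_two_of_quartic_root (h4 : Module.finrank K L = 4) {θ : 𝓞 L} (hθ : θ ^ 4 - 4 * θ ^ 2 + 2 = 0)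
    (𝔭₁ : Ideal (𝓞 K)) (hN : Ideal.absNorm 𝔭₁ = 2) (hunr : (2 : 𝓞 K) ∉ 𝔭₁ ^ 2)
    (P : Ideal (𝓞 L)) [P.IsMaximal] [P.LiesOver 𝔭₁] : Nat.card (𝓞 L ⧸ P) = 2 := by
  obtain ⟨h𝔭, h𝔭0, h2𝔭, -⟩ := isPrime_and_mem_of_absNorm_eq_two 𝔭₁ hN
  haveI := h𝔭
  haveI : 𝔭₁.IsMaximal := h𝔭.isMaximal h𝔭0
  obtain ⟨-, -, hf⟩ := ramificationIdx_eq_four_of_quartic_root h4 hθ 𝔭₁ h2𝔭 hunr P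
  rw [Ideal.inertiaDegIn_eq_inertiaDeg 𝔭₁ P (L ≃ₐ[K] L)] at hf
  have h := Ideal.absNorm_eq_pow_inertiaDeg'_of_liesOver P 𝔭₁ h𝔭 h𝔭0
  rw [Ideal.inertiaDeg'_eq_inertiaDeg 𝔭₁ P, hf, hN, pow_one] at h
  rw [← Submodule.cardQuot_apply, ← Ideal.absNorm_apply, h]

/-- **Valuations at `P`: `v_P(2) = 4`, `v_P(θ) = 1`, `v_P(2 + θ) = 1`** (`θ ∈ 𝓞_L`, `θ⁴ − 4θ² + 2 = 0`): `2 ∈ P⁴ ∖ P⁵`, `θ ∈ P ∖ P²` and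
`2 + θ ∈ P ∖ P²` — the hypotheses `e = 4`, `𝔭 ‖ m` (with `m = 2 + θ`, the relative generator of the next layer `L(√(2+θ))`) of the dyadic non-norm
lemma at `e = 4`, `f = 1`.  (`θ⁴ = 2(2θ² − 1) ∈ P` gives `θ ∈ P`; `θ ∈ P²` would give `2 = 4θ² − θ⁴ ∈ P⁵`.) [cite: NeukirchANT1999, Ch. I §8 Prop. (8.2)]
[cite: Omeara1963, §63A (63:1)] -/
theorem two_mem_pow_four_and_mem_of_quartic_root (h4 : Module.finrank K L = 4) {θ : 𝓞 L} (hθ : θ ^ 4 - 4 * θ ^ 2 + 2 = 0)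
    (𝔭₁ : Ideal (𝓞 K)) [𝔭₁.IsPrime] (h2𝔭 : (2 : 𝓞 K) ∈ 𝔭₁) (hunr : (2 : 𝓞 K) ∉ 𝔭₁ ^ 2)
    (P : Ideal (𝓞 L)) [P.IsPrime] [P.LiesOver 𝔭₁] :
    ((2 : 𝓞 L) ∈ P ^ 4 ∧ (2 : 𝓞 L) ∉ P ^ 5) ∧ (θ ∈ P ∧ θ ∉ P ^ 2) ∧ (2 + θ ∈ P ∧ 2 + θ ∉ P ^ 2) := by
  classical
  haveI := liesOver_span_two₄ h2𝔭
  haveI : P.LiesOver (Ideal.span {(2 : ℤ)}) := Ideal.LiesOver.trans P 𝔭₁ _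
  have hP0 : P ≠ ⊥ := Ideal.ne_bot_of_liesOver_of_ne_bot (by simp : Ideal.span {(2 : ℤ)} ≠ ⊥) P
  obtain ⟨he4, -, -⟩ := ramificationIdx_eq_four_of_quartic_root h4 hθ 𝔭₁ h2𝔭 hunr P
  -- `e(P | 2ℤ) = e(𝔭₁ | 2ℤ) · e(P | 𝔭₁) = 4`
  have hP2 : P.under (𝓞 K) = 𝔭₁ := (Ideal.over_def P 𝔭₁).symm
  have htower : P.ramificationIdx ℤ = 4 := by
    have h := Ideal.ramificationIdx_tower (P.under (𝓞 K)) P (R := ℤ)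
    rw [hP2, ramificationIdx_int_eq_one_of_two_not_mem_sq 𝔭₁ h2𝔭 hunr, one_mul, he4] at h
    exact h
  have hmap : Ideal.map (algebraMap ℤ (𝓞 L)) (Ideal.span {(2 : ℤ)}) = Ideal.span {(2 : 𝓞 L)} := by
    rw [Ideal.map_span, Set.image_singleton, map_ofNat]
  have hp0 : Ideal.map (algebraMap ℤ (𝓞 L)) (Ideal.span {(2 : ℤ)}) ≠ ⊥ := Ideal.map_ne_bot_of_ne_bot (by simp)
  have hcount : (normalizedFactors (Ideal.span {(2 : 𝓞 L)})).count P = 4 := by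
    rw [← hmap, ← Ideal.IsDedekindDomain.ramificationIdx_eq_normalizedFactors_count (Ideal.span {(2 : ℤ)}) P hp0, htower]
  have h20 : (2 : 𝓞 L) ≠ 0 := two_ne_zero
  have h2P4 : (2 : 𝓞 L) ∈ P ^ 4 := (mem_pow_iff_le_count₄ hP0 h20 4).mpr (by rw [hcount])
  have h2P5 : (2 : 𝓞 L) ∉ P ^ 5 := fun h => by
    have := (mem_pow_iff_le_count₄ hP0 h20 5).mp h
    rw [hcount] at this
    omega
  have h2P : (2 : 𝓞 L) ∈ P := Ideal.pow_le_self (by norm_num) h2P4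
  -- `θ ∈ P ∖ P²`
  have hθ4 : θ ^ 4 = 2 * (2 * θ ^ 2 - 1) := by linear_combination hθ
  have hθP : θ ∈ P := by
    have h : θ ^ 4 ∈ P := by rw [hθ4]; exact P.mul_mem_right _ h2P
    exact (inferInstance : P.IsPrime).mem_of_pow_mem 4 h
  have hθP2 : θ ∉ P ^ 2 := fun h => by
    have h8 : θ ^ 4 ∈ P ^ 5 := by
      have : θ ^ 4 ∈ (P ^ 2) ^ 4 := Ideal.pow_mem_pow h 4
      rw [← pow_mul] at this
      exact Ideal.pow_le_pow_right (by norm_num) this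
    have h44 : (4 : 𝓞 L) * θ ^ 2 ∈ P ^ 5 := by
      have h22 : (4 : 𝓞 L) = 2 * 2 := by norm_num
      have : (2 : 𝓞 L) * 2 * θ ∈ P ^ 4 * P := Ideal.mul_mem_mul (Ideal.mul_mem_right _ _ h2P4) hθP
      rw [← pow_succ] at this
      rw [h22, sq, ← mul_assoc]
      exact Ideal.mul_mem_right _ _ this
    apply h2P5
    have : (2 : 𝓞 L) = 4 * θ ^ 2 - θ ^ 4 := by linear_combination hθ
    rw [this]
    exact (P ^ 5).sub_mem h44 h8
  refine ⟨⟨h2P4, h2P5⟩, ⟨hθP, hθP2⟩, P.add_mem h2P hθP, fun h => hθP2 ?_⟩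
  have : (2 + θ) - 2 ∈ P ^ 2 := (P ^ 2).sub_mem h (Ideal.pow_le_pow_right (by norm_num) h2P4)
  rwa [add_sub_cancel_left] at this

/-- **`v_P(π₁) = 4` for `π₁ ∈ 𝔭₁ ∖ 𝔭₁²`**: the image of `π₁` in `𝓞_L` lies in `P⁴ ∖ P⁵` (`𝔭₁𝓞_L ≤ P⁴` by `e(P | 𝔭₁) = 4`, and
`𝔭₁ = (π₁) + 𝔭₁²`, so `π₁ ∈ P⁵` would give `𝔭₁𝓞_L ≤ P⁵`). [cite: NeukirchANT1999, Ch. I §8 Prop. (8.2)] -/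
theorem algebraMap_mem_pow_four_of_mem_of_not_mem_sq (h4 : Module.finrank K L = 4) {θ : 𝓞 L} (hθ : θ ^ 4 - 4 * θ ^ 2 + 2 = 0)
    (𝔭₁ : Ideal (𝓞 K)) [𝔭₁.IsPrime] (h2𝔭 : (2 : 𝓞 K) ∈ 𝔭₁) (hunr : (2 : 𝓞 K) ∉ 𝔭₁ ^ 2)
    (P : Ideal (𝓞 L)) [P.IsPrime] [P.LiesOver 𝔭₁] {π₁ : 𝓞 K} (hπ₁ : π₁ ∈ 𝔭₁) (hπ₁' : π₁ ∉ 𝔭₁ ^ 2) :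
    algebraMap (𝓞 K) (𝓞 L) π₁ ∈ P ^ 4 ∧ algebraMap (𝓞 K) (𝓞 L) π₁ ∉ P ^ 5 := by
  classical
  have h𝔭0 : 𝔭₁ ≠ ⊥ := fun h => hπ₁' (by rw [h] at hπ₁; rw [(Ideal.mem_bot.mp hπ₁)]; exact zero_mem _)
  have hP0 : P ≠ ⊥ := Ideal.ne_bot_of_liesOver_of_ne_bot h𝔭0 P
  obtain ⟨he4, -, -⟩ := ramificationIdx_eq_four_of_quartic_root h4 hθ 𝔭₁ h2𝔭 hunr P
  have hmap0 : Ideal.map (algebraMap (𝓞 K) (𝓞 L)) 𝔭₁ ≠ ⊥ := Ideal.map_ne_bot_of_ne_bot h𝔭0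
  have hcount : (normalizedFactors (Ideal.map (algebraMap (𝓞 K) (𝓞 L)) 𝔭₁)).count P = 4 := by
    rw [← Ideal.IsDedekindDomain.ramificationIdx_eq_normalizedFactors_count 𝔭₁ P hmap0, he4]
  have hmapP4 : Ideal.map (algebraMap (𝓞 K) (𝓞 L)) 𝔭₁ ≤ P ^ 4 :=
    (le_pow_iff_le_count₄ hP0 hmap0 4).mpr (by rw [hcount])
  refine ⟨hmapP4 (Ideal.mem_map_of_mem _ hπ₁), fun h5 => ?_⟩
  -- `𝔭₁ = (π₁) + 𝔭₁²`
  have h𝔭eq : Ideal.span {π₁} ⊔ 𝔭₁ ^ 2 = 𝔭₁ ^ 1 := by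
    refine Ideal.eq_prime_pow_of_succ_lt_of_le h𝔭0 (lt_of_le_of_ne le_sup_right fun h => hπ₁' ?_) ?_
    · rw [h]; exact Ideal.mem_sup_left (Ideal.mem_span_singleton_self π₁)
    · rw [pow_one]; exact sup_le (by rwa [Ideal.span_singleton_le_iff_mem]) (Ideal.pow_le_self two_ne_zero)
  rw [pow_one] at h𝔭eq
  have hle5 : Ideal.map (algebraMap (𝓞 K) (𝓞 L)) 𝔭₁ ≤ P ^ 5 := by
    conv_lhs => rw [← h𝔭eq]
    rw [Ideal.map_sup, Ideal.map_pow, Ideal.map_span, Set.image_singleton]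
    refine sup_le (by rwa [Ideal.span_singleton_le_iff_mem]) ?_
    calc Ideal.map (algebraMap (𝓞 K) (𝓞 L)) 𝔭₁ ^ 2 ≤ (P ^ 4) ^ 2 := Ideal.pow_right_mono hmapP4 2
      _ = P ^ 8 := by rw [← pow_mul]
      _ ≤ P ^ 5 := Ideal.pow_le_pow_right (by norm_num)
  have := (le_pow_iff_le_count₄ hP0 hmap0 5).mp hle5
  rw [hcount] at this
  omega

/-- ★★ **THE BASE-FIELD CERTIFICATE ⟹ `η − 1 ∈ P⁸ ∖ P⁹`.**  With `η = A + Bθ + Cθ² + Dθ³ ∈ 𝓞_L` (`A, B, C, D ∈ 𝓞_K`) and elements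
`π₁ ∈ 𝔭₁ ∖ 𝔭₁²`, `d, γ₀ ∉ 𝔭₁`, `γ₁, γ₂, γ₃` of `𝓞_K` such that `d(A − 1) = π₁²γ₀`, `dB = π₁²γ₁`, `dC = π₁²γ₂`, `dD = π₁²γ₃`: then
`d(η − 1) = π₁²(γ₀ + γ₁θ + γ₂θ² + γ₃θ³)` with `v_P(d) = 0`, `v_P(π₁) = 4`, `v_P(γ₀ + γ₁θ + γ₂θ² + γ₃θ³) = 0` (`θ ∈ P`, `γ₀ ∉ P`), so
`v_P(η − 1) = 8`.  Every hypothesis is an identity or an ideal membership in `𝓞_K` (and does not see which root `θ` of `X⁴ − 4X² + 2` is used).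
[cite: Omeara1963, §63A (63:1), §63B (63:10)] [cite: NeukirchANT1999, Ch. I §8 Prop. (8.2)] -/
theorem sub_one_mem_pow_eight_of_baseCert (h4 : Module.finrank K L = 4) {θ : 𝓞 L} (hθ : θ ^ 4 - 4 * θ ^ 2 + 2 = 0)
    (𝔭₁ : Ideal (𝓞 K)) [𝔭₁.IsPrime] (h2𝔭 : (2 : 𝓞 K) ∈ 𝔭₁) (hunr : (2 : 𝓞 K) ∉ 𝔭₁ ^ 2)
    (P : Ideal (𝓞 L)) [P.IsPrime] [P.LiesOver 𝔭₁] {A B C D π₁ d γ₀ γ₁ γ₂ γ₃ : 𝓞 K} (hπ₁ : π₁ ∈ 𝔭₁) (hπ₁' : π₁ ∉ 𝔭₁ ^ 2)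
    (hd : d ∉ 𝔭₁) (hγ₀ : γ₀ ∉ 𝔭₁) (hA : d * (A - 1) = π₁ ^ 2 * γ₀) (hB : d * B = π₁ ^ 2 * γ₁)
    (hC : d * C = π₁ ^ 2 * γ₂) (hD : d * D = π₁ ^ 2 * γ₃) :
    algebraMap (𝓞 K) (𝓞 L) A + algebraMap (𝓞 K) (𝓞 L) B * θ + algebraMap (𝓞 K) (𝓞 L) C * θ ^ 2 +
          algebraMap (𝓞 K) (𝓞 L) D * θ ^ 3 - 1 ∈ P ^ 8 ∧
      algebraMap (𝓞 K) (𝓞 L) A + algebraMap (𝓞 K) (𝓞 L) B * θ + algebraMap (𝓞 K) (𝓞 L) C * θ ^ 2 +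
          algebraMap (𝓞 K) (𝓞 L) D * θ ^ 3 - 1 ∉ P ^ 9 := by
  classical
  set f := algebraMap (𝓞 K) (𝓞 L) with hf
  have h𝔭0 : 𝔭₁ ≠ ⊥ := fun h => hπ₁' (by rw [h] at hπ₁; rw [(Ideal.mem_bot.mp hπ₁)]; exact zero_mem _)
  have hP0 : P ≠ ⊥ := Ideal.ne_bot_of_liesOver_of_ne_bot h𝔭0 P
  have hunder : ∀ x : 𝓞 K, f x ∈ P ↔ x ∈ 𝔭₁ := fun x => by
    rw [hf, ← Ideal.mem_comap, ← Ideal.under_def, ← Ideal.over_def P 𝔭₁]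
  obtain ⟨-, ⟨hθP, -⟩, -⟩ := two_mem_pow_four_and_mem_of_quartic_root h4 hθ 𝔭₁ h2𝔭 hunr P
  obtain ⟨hπP4, hπP5⟩ := algebraMap_mem_pow_four_of_mem_of_not_mem_sq h4 hθ 𝔭₁ h2𝔭 hunr P hπ₁ hπ₁'
  -- the identity `d (η - 1) = π₁² (γ₀ + γ₁ θ + γ₂ θ² + γ₃ θ³)`
  set w := f A + f B * θ + f C * θ ^ 2 + f D * θ ^ 3 - 1 with hw
  set γ := f γ₀ + f γ₁ * θ + f γ₂ * θ ^ 2 + f γ₃ * θ ^ 3 with hγ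
  have hident : f d * w = f π₁ ^ 2 * γ := by
    have hA' := congrArg f hA
    have hB' := congrArg f hB
    have hC' := congrArg f hC
    have hD' := congrArg f hD
    simp only [map_mul, map_sub, map_one, map_pow] at hA' hB' hC' hD'
    rw [hw, hγ]
    linear_combination hA' + θ * hB' + θ ^ 2 * hC' + θ ^ 3 * hD'
  -- valuations: `v_P(d) = 0`, `v_P(γ) = 0`, `v_P(π₁) = 4`
  have hdP : f d ∉ P := fun h => hd ((hunder d).mp h)
  have hγP : γ ∉ P := fun h => hγ₀ ((hunder γ₀).mp (by
    have : γ - (f γ₁ + f γ₂ * θ + f γ₃ * θ ^ 2) * θ ∈ P := P.sub_mem h (P.mul_mem_left _ hθP)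
    have hγeq : γ - (f γ₁ + f γ₂ * θ + f γ₃ * θ ^ 2) * θ = f γ₀ := by rw [hγ]; ring
    rwa [hγeq] at this))
  have hd0 : f d ≠ 0 := fun h => hdP (by rw [h]; exact zero_mem _)
  have hγ0 : γ ≠ 0 := fun h => hγP (by rw [h]; exact zero_mem _)
  have hπ0 : f π₁ ≠ 0 := fun h => hπP5 (by rw [h]; exact zero_mem _)
  have hw0 : w ≠ 0 := fun h => by
    rw [h, mul_zero] at hident
    exact (mul_ne_zero (pow_ne_zero 2 hπ0) hγ0) hident.symm
  have hcd : (normalizedFactors (Ideal.span {f d})).count P = 0 :=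
    count_span_eq_of_mem_of_not_mem₄ (by rw [pow_zero, Ideal.one_eq_top]; exact Submodule.mem_top) (by rwa [pow_one])
  have hcγ : (normalizedFactors (Ideal.span {γ})).count P = 0 :=
    count_span_eq_of_mem_of_not_mem₄ (by rw [pow_zero, Ideal.one_eq_top]; exact Submodule.mem_top) (by rwa [pow_one])
  have hcπ : (normalizedFactors (Ideal.span {f π₁})).count P = 4 := count_span_eq_of_mem_of_not_mem₄ hπP4 hπP5
  have hcw : (normalizedFactors (Ideal.span {w})).count P = 8 := by
    have h : (normalizedFactors (Ideal.span {f d * w})).count P =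
        (normalizedFactors (Ideal.span {f π₁ ^ 2 * γ})).count P := by rw [hident]
    rw [count_span_mul₄ hd0 hw0, count_span_mul₄ (pow_ne_zero 2 hπ0) hγ0, sq, count_span_mul₄ hπ0 hπ0,
      hcd, hcγ, hcπ] at h
    omega
  refine ⟨(mem_pow_iff_le_count₄ hP0 hw0 8).mpr (by rw [hcw]), fun h => ?_⟩
  have := (mem_pow_iff_le_count₄ hP0 hw0 9).mp h
  rw [hcw] at this
  omega

end Quartic

end Literature.NumberTheory.IwasawaTheory

end
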